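import Mathlib
import Literature.Barriers.ValiantsHypothesis.AlgebraicNaturalProofs
import Literature.Computability.AlgebraicComplexity.ArithCircuitProofs
import Summits.ValiantsHypothesis.ValiantsHypothesis.Theorems.BarrierLeverPartitionMinorsHitByVPProductStates
import Summits.ValiantsHypothesis.ValiantsHypothesis.Theorems.BarrierLeverPartitionMinorsHitByVPTwoBlockTropical

/-!
# Route BarrierLever — item `PartitionMinorsHitByVP` (stmt-ValiantsHypothesis-19717):
# GENERAL product states (arbitrary complex site tables) — coefficients, degree, size

Helper file (`--supports stmt-ValiantsHypothesis-19717`; cell valiant-natproofs, rung V4, 𝒟-side,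
prover seat valiant-natproofs-prover gen 6). Definition-free. Closes NO item. Part 2a of the
bi-threshold door D-THR (memo `HOME/prover/gen6/ADAPTIVE-WITNESSES-MEMO-g6.md` §7): the cell's
`…ProductStates` file treats site tables of the special form `T ^ φ`; the door needs ARBITRARY
complex site tables `m a ε η` (the threshold scaling multiplies the entries by powers of a point
`x₀ ∈ ℂ`). The proofs are the cell's, verbatim up to the entry.

* `coeff_prodStateC` — `coeff_{x^U y^W} ∏_a (Σ_{ε,η} C (m a ε η) x_a^ε y_{π a}^η) = ∏_a m a [a∈U] [π a∈W]`;
* `totalDegree_prodStateC_le` (≤ 2h), `complexity_prodStateC_le` (≤ 13 h).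
-/

set_option linter.dupNamespace false

namespace Summit.ValiantsHypothesis.ValiantsHypothesis.Theorems.BarrierLever.ProductStatesC

open Finset MvPolynomial
open Literature.Barriers.ValiantsHypothesis Literature.Computability.AlgebraicComplexity
open Summit.ValiantsHypothesis.ValiantsHypothesis.Theorems.BarrierLever.ProductStateSums
  (castAdd_ne_natAdd patternExpo_eq_partitionExpo_iff complexity_X_pow_toNat)

noncomputable section

variable {h : ℕ}

/-- A general site polynomial as a sum of four monomials. -/
theorem siteC_eq_sum_monomial (m : Fin h → Bool → Bool → ℂ) (π : Equiv.Perm (Fin h)) (a : Fin h) :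
    (∑ p : Bool × Bool, C (m a p.1 p.2) * X (Fin.castAdd h a) ^ p.1.toNat *
        X (Fin.natAdd h (π a)) ^ p.2.toNat : MvPolynomial (Fin (h + h)) ℂ) =
      ∑ p : Bool × Bool, monomial (Finsupp.single (Fin.castAdd h a) p.1.toNat +
        Finsupp.single (Fin.natAdd h (π a)) p.2.toNat) (m a p.1 p.2) := by
  refine Finset.sum_congr rfl fun p _ => ?_
  rw [X_pow_eq_monomial, X_pow_eq_monomial, C_mul_monomial, monomial_mul, mul_one, mul_one]

/-- A general product state expanded over bit patterns. -/
theorem prodStateC_eq_sum_monomial (m : Fin h → Bool → Bool → ℂ) (π : Equiv.Perm (Fin h)) :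
    (∏ a, ∑ p : Bool × Bool, C (m a p.1 p.2) * X (Fin.castAdd h a) ^ p.1.toNat *
        X (Fin.natAdd h (π a)) ^ p.2.toNat : MvPolynomial (Fin (h + h)) ℂ) =
      ∑ g : Fin h → Bool × Bool, monomial
        (∑ a, (Finsupp.single (Fin.castAdd h a) (g a).1.toNat +
          Finsupp.single (Fin.natAdd h (π a)) (g a).2.toNat))
        (∏ a, m a (g a).1 (g a).2) := by
  simp_rw [siteC_eq_sum_monomial]
  rw [Fintype.prod_sum]
  refine Finset.sum_congr rfl fun g _ => ?_
  rw [monomial_sum_prod]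

/-- **Coefficient of a general product state**:
`coeff_{x^U y^W} (∏_a q_a) = ∏_a m a [a ∈ U] [π a ∈ W]`. -/
theorem coeff_prodStateC (m : Fin h → Bool → Bool → ℂ) (π : Equiv.Perm (Fin h))
    (U W : Finset (Fin h)) :
    coeff (∑ a ∈ U, Finsupp.single (Fin.castAdd h a) 1 + ∑ c ∈ W, Finsupp.single (Fin.natAdd h c) 1)
      (∏ a, ∑ p : Bool × Bool, C (m a p.1 p.2) * X (Fin.castAdd h a) ^ p.1.toNat *
        X (Fin.natAdd h (π a)) ^ p.2.toNat : MvPolynomial (Fin (h + h)) ℂ) =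
      ∏ a, m a (decide (a ∈ U)) (decide (π a ∈ W)) := by
  rw [prodStateC_eq_sum_monomial, coeff_sum]
  simp_rw [coeff_monomial]
  rw [Finset.sum_eq_single (fun a => (decide (a ∈ U), decide (π a ∈ W)))]
  · rw [if_pos ((patternExpo_eq_partitionExpo_iff π _ U W).mpr rfl)]
  · intro g _ hg
    rw [if_neg]
    rwa [patternExpo_eq_partitionExpo_iff]
  · intro hn; exact absurd (mem_univ _) hn

/-- A general site polynomial has degree `≤ 2`. -/
theorem totalDegree_siteC_le (m : Fin h → Bool → Bool → ℂ) (π : Equiv.Perm (Fin h)) (a : Fin h) :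
    (∑ p : Bool × Bool, C (m a p.1 p.2) * X (Fin.castAdd h a) ^ p.1.toNat *
        X (Fin.natAdd h (π a)) ^ p.2.toNat : MvPolynomial (Fin (h + h)) ℂ).totalDegree ≤ 2 := by
  refine (totalDegree_finsetSum _ _).trans (Finset.sup_le fun p _ => ?_)
  calc (C (m a p.1 p.2) * X (Fin.castAdd h a) ^ p.1.toNat *
          X (Fin.natAdd h (π a)) ^ p.2.toNat).totalDegree
      ≤ (C (m a p.1 p.2) * X (Fin.castAdd h a) ^ p.1.toNat).totalDegree +
          (X (Fin.natAdd h (π a)) ^ p.2.toNat : MvPolynomial (Fin (h + h)) ℂ).totalDegree :=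
        totalDegree_mul _ _
    _ ≤ ((C (m a p.1 p.2) : MvPolynomial (Fin (h + h)) ℂ).totalDegree +
          (X (Fin.castAdd h a) ^ p.1.toNat : MvPolynomial (Fin (h + h)) ℂ).totalDegree) +
          (X (Fin.natAdd h (π a)) ^ p.2.toNat : MvPolynomial (Fin (h + h)) ℂ).totalDegree := by
        gcongr; exact totalDegree_mul _ _
    _ ≤ (0 + p.1.toNat) + p.2.toNat := by
        gcongr
        · exact (totalDegree_C _).le
        · exact (totalDegree_pow _ _).trans (by rw [totalDegree_X]; simp)
        · exact (totalDegree_pow _ _).trans (by rw [totalDegree_X]; simp)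
    _ ≤ (0 + 1) + 1 := by gcongr <;> exact Bool.toNat_le _
    _ = 2 := by norm_num

/-- A general product state has degree `≤ 2h`. -/
theorem totalDegree_prodStateC_le (m : Fin h → Bool → Bool → ℂ) (π : Equiv.Perm (Fin h)) :
    (∏ a, ∑ p : Bool × Bool, C (m a p.1 p.2) * X (Fin.castAdd h a) ^ p.1.toNat *
        X (Fin.natAdd h (π a)) ^ p.2.toNat : MvPolynomial (Fin (h + h)) ℂ).totalDegree ≤ h + h := by
  calc (∏ a, ∑ p : Bool × Bool, C (m a p.1 p.2) * X (Fin.castAdd h a) ^ p.1.toNat *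
          X (Fin.natAdd h (π a)) ^ p.2.toNat : MvPolynomial (Fin (h + h)) ℂ).totalDegree
      ≤ ∑ a, (∑ p : Bool × Bool, C (m a p.1 p.2) * X (Fin.castAdd h a) ^ p.1.toNat *
          X (Fin.natAdd h (π a)) ^ p.2.toNat : MvPolynomial (Fin (h + h)) ℂ).totalDegree :=
        totalDegree_finsetProd _ _
    _ ≤ ∑ _a : Fin h, 2 := Finset.sum_le_sum fun a _ => totalDegree_siteC_le m π a
    _ = h + h := by simp; ring

/-- A general site polynomial has size `≤ 12`. -/
theorem complexity_siteC_le (m : Fin h → Bool → Bool → ℂ) (π : Equiv.Perm (Fin h)) (a : Fin h) :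
    complexity (∑ p : Bool × Bool, C (m a p.1 p.2) * X (Fin.castAdd h a) ^ p.1.toNat *
        X (Fin.natAdd h (π a)) ^ p.2.toNat : MvPolynomial (Fin (h + h)) ℂ) ≤ 12 := by
  have hsum : ∀ p : Bool × Bool, complexity (C (m a p.1 p.2) * X (Fin.castAdd h a) ^ p.1.toNat *
      X (Fin.natAdd h (π a)) ^ p.2.toNat : MvPolynomial (Fin (h + h)) ℂ) ≤ 2 := by
    intro p
    calc complexity (C (m a p.1 p.2) * X (Fin.castAdd h a) ^ p.1.toNat *
            X (Fin.natAdd h (π a)) ^ p.2.toNat : MvPolynomial (Fin (h + h)) ℂ)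
        ≤ complexity (C (m a p.1 p.2) * X (Fin.castAdd h a) ^ p.1.toNat :
              MvPolynomial (Fin (h + h)) ℂ) +
            complexity (X (Fin.natAdd h (π a)) ^ p.2.toNat : MvPolynomial (Fin (h + h)) ℂ) + 1 :=
          complexity_mul_le_holds _ _
      _ ≤ (complexity (C (m a p.1 p.2) : MvPolynomial (Fin (h + h)) ℂ) +
            complexity (X (Fin.castAdd h a) ^ p.1.toNat : MvPolynomial (Fin (h + h)) ℂ) + 1) +
            complexity (X (Fin.natAdd h (π a)) ^ p.2.toNat : MvPolynomial (Fin (h + h)) ℂ) + 1 := by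
          gcongr; exact complexity_mul_le_holds _ _
      _ = 2 := by
          rw [complexity_C_holds, complexity_X_pow_toNat, complexity_X_pow_toNat]
  calc complexity (∑ p : Bool × Bool, C (m a p.1 p.2) * X (Fin.castAdd h a) ^ p.1.toNat *
          X (Fin.natAdd h (π a)) ^ p.2.toNat)
      ≤ ∑ p : Bool × Bool, complexity (C (m a p.1 p.2) * X (Fin.castAdd h a) ^ p.1.toNat *
          X (Fin.natAdd h (π a)) ^ p.2.toNat : MvPolynomial (Fin (h + h)) ℂ) +
          (univ : Finset (Bool × Bool)).card := complexity_finset_sum_le _ _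
    _ ≤ ∑ _p : Bool × Bool, 2 + (univ : Finset (Bool × Bool)).card := by
        gcongr with p _; exact hsum p
    _ = 12 := by simp

/-- A general product state has size `≤ 13h`. -/
theorem complexity_prodStateC_le (m : Fin h → Bool → Bool → ℂ) (π : Equiv.Perm (Fin h)) :
    complexity (∏ a, ∑ p : Bool × Bool, C (m a p.1 p.2) * X (Fin.castAdd h a) ^ p.1.toNat *
        X (Fin.natAdd h (π a)) ^ p.2.toNat : MvPolynomial (Fin (h + h)) ℂ) ≤ 13 * h := by
  calc complexity (∏ a, ∑ p : Bool × Bool, C (m a p.1 p.2) * X (Fin.castAdd h a) ^ p.1.toNat *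
          X (Fin.natAdd h (π a)) ^ p.2.toNat : MvPolynomial (Fin (h + h)) ℂ)
      ≤ ∑ a, complexity (∑ p : Bool × Bool, C (m a p.1 p.2) * X (Fin.castAdd h a) ^ p.1.toNat *
          X (Fin.natAdd h (π a)) ^ p.2.toNat : MvPolynomial (Fin (h + h)) ℂ) +
          (univ : Finset (Fin h)).card := complexity_finset_prod_le _ _
    _ ≤ ∑ _a : Fin h, 12 + (univ : Finset (Fin h)).card := by
        gcongr with a _; exact complexity_siteC_le m π a
    _ = 13 * h := by simp; ring

/-- **Two scaled general product states**: `C k₁ · P + C k₂ · Q ∈ SmallCircuits ℂ (h+h) 3` for `h ≥ 4`,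
with the stated coefficient. -/
theorem twoProdStatesC_mem_smallCircuits (hh : 4 ≤ h) (k₁ k₂ : ℂ) (m₁ m₂ : Fin h → Bool → Bool → ℂ) :
    (C k₁ * (∏ a, ∑ p : Bool × Bool, C (m₁ a p.1 p.2) * X (Fin.castAdd h a) ^ p.1.toNat *
        X (Fin.natAdd h ((Equiv.refl (Fin h)) a)) ^ p.2.toNat) +
      C k₂ * (∏ a, ∑ p : Bool × Bool, C (m₂ a p.1 p.2) * X (Fin.castAdd h a) ^ p.1.toNat *
        X (Fin.natAdd h ((Equiv.refl (Fin h)) a)) ^ p.2.toNat) : MvPolynomial (Fin (h + h)) ℂ) ∈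
      SmallCircuits ℂ (h + h) 3 := by
  refine ⟨?_, ?_⟩
  · refine (totalDegree_add _ _).trans (max_le ?_ ?_) <;>
      refine (totalDegree_mul _ _).trans ?_ <;> rw [totalDegree_C, zero_add] <;>
      exact totalDegree_prodStateC_le _ _
  · calc _ ≤ complexity (C k₁ * (∏ a, ∑ p : Bool × Bool, C (m₁ a p.1 p.2) *
            X (Fin.castAdd h a) ^ p.1.toNat * X (Fin.natAdd h ((Equiv.refl (Fin h)) a)) ^ p.2.toNat) :
            MvPolynomial (Fin (h + h)) ℂ) +
          complexity (C k₂ * (∏ a, ∑ p : Bool × Bool, C (m₂ a p.1 p.2) *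
            X (Fin.castAdd h a) ^ p.1.toNat * X (Fin.natAdd h ((Equiv.refl (Fin h)) a)) ^ p.2.toNat) :
            MvPolynomial (Fin (h + h)) ℂ) + 1 := complexity_add_le_holds _ _
      _ ≤ (0 + 13 * h + 1) + (0 + 13 * h + 1) + 1 := by
          gcongr <;>
          · refine (complexity_mul_le_holds _ _).trans ?_
            gcongr
            · exact (complexity_C_holds _).le
            · exact complexity_prodStateC_le _ _
      _ ≤ (h + h) ^ 3 := by
          have h8 : 8 ≤ h + h := by omega
          have h64 : 64 ≤ (h + h) * (h + h) := by nlinarith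
          calc 0 + 13 * h + 1 + (0 + 13 * h + 1) + 1 = 26 * h + 3 := by ring
            _ ≤ (h + h) * ((h + h) * (h + h)) := by nlinarith
            _ = (h + h) ^ 3 := by ring

end

end Summit.ValiantsHypothesis.ValiantsHypothesis.Theorems.BarrierLever.ProductStatesC
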